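import Mathlib
import HarnessLib
import Summits.NavierStokesRegularity.NavierStokesRegularity.Theorems.PoloidalWindowDoorLrcModEntireTwistingTHFlatRidgeQuarticPin
import Summits.NavierStokesRegularity.NavierStokesRegularity.Theorems.PoloidalWindowDoorLrcModEntireTwistingTHFlatRidgeQuarticLaw

/-!
# Item `LrcModEntire` (stmt-NavierStokesRegularity-20428) — THE FLAT SUB-CELL: the BRANCH-FREE fourth-order pin `72ρ₀²q ≤ 3|N|/4 − σθ_tt` at every flat hot point,
# in the direction normal to a hot secant

ns-k2-port-2 g7, helper of item 20428 under LEAD ns-poloidal-K2-p3 g15 (`--supports stmt-NavierStokesRegularity-20428 --as helper`).  Memo `Cruxes/LrcModEntire/T2B-g15.md`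
§17d: `72ρ₀²q ≤ 3N/4 − θ_tt` on the flat hot web, `q` the transversal quartic coefficient.  The memo derives it in Fermi coordinates of a smooth flat BRANCH; here it is typed
WITHOUT any branch: at a flat hot point `y ∈ P₀` of a `stub_T2bFlat` profile (flat ridge law at EVERY hot point of `P₀`, «no compact isolated hot piece» ⇒ hot points
accumulate at `y`), a limit `T` of unit secants to hot points is horizontal and — because the Hessian AND the third derivative of `θ = v₂(−1,·)` vanish at every hot point
(`…FlatRidgeThirdJet`) — the little-o of `D³θ` at `y` gives **`D⁴θ(y)[T,·,·,·] = 0`** (`exists_secantKernel_of_flatHotPoint`; the LEAD's `…RidgeGlobalBranch.exists_kernel_direction`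
one order up).  With the Schwarz symmetries of `D⁴` (`fourthDeriv_symm_outer/inner/middle`) the horizontal trace splits, for the unit normal `ν = JT`:
`D²(Δₕθ)(y)[ν,ν] = ∂_ν⁴θ(y) + D⁴θ(y)[ν,ν,T,T] = ∂_ν⁴θ(y)`.  First the two fourth-order files are assembled:

* `quarticSliceTimePin_of_flatHotPoint` — `…QuarticPin` (`3b² ≤ (σθ_tt − 3|N|/4)·σ∂_ν⁴θ`, `b = ∂_ν²θ_t`) + `…QuarticLaw` (`∂_ν²θ_t = ∂_ν²Δθ = ρ₀∂_ν²Δₕθ`):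
  **`∃ ρ₀ ≥ 1, 3ρ₀²·(D²(Δₕv₂(−1,·))(y)[ν,ν])² ≤ (σ∂ₜ²v₂(−1,y) − 3|N|/4)·σ∂_ν⁴θ(y)`** for every horizontal `ν`;
* ★ `secantQuarticPin_of_flatHotPoint` — **`∃` unit horizontal `ν` (normal to a hot secant direction) and `ρ₀ ≥ 1` with `3ρ₀²·(−σ∂_ν⁴θ(y)) ≤ 3|N|/4 − σ∂ₜ²v₂(−1,y)`**, i.e.
  `72ρ₀²q ≤ 3|N|/4 − σθ_tt` with `q := −σ∂_ν⁴θ(y)/24 ≥ 0` (`…QuarticPin.quarticSign_of_flatHotPoint`).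

WHAT THIS IS NOT: not a claim about Navier–Stokes regularity and not a proof of `stub_T2bFlat`; a fourth-order point inequality for the OPEN flat sub-cell (memo §17e: R-e currency,
not decisive alone) (bears_on LADDER-NS N0, item 20428 / crux 19708; OPEN).
-/

set_option linter.style.longLine false
set_option linter.dupNamespace false

namespace Summit.NavierStokesRegularity.NavierStokesRegularity.Theorems.PoloidalWindowDoorLrcModEntireTwistingTHFlatRidgeSecantPin

open Set Function Filter Topology Metric
open scoped RealInnerProductSpace InnerProductSpace ContDiff Laplacian
open Literature.Analysis Literature.Analysis.FluidPDE Literature.Analysis.UnboundedOperators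
open Summit.NavierStokesRegularity.NavierStokesRegularity.Theorems
open Summit.NavierStokesRegularity.NavierStokesRegularity.Theorems.LocalSineTubeDoorProfileAlignedWindowRigidityAncient
open Summit.NavierStokesRegularity.NavierStokesRegularity.Theorems.PoloidalWindowDoorPoloidalWindowRigidityWindow
open Summit.NavierStokesRegularity.NavierStokesRegularity.Theorems.PoloidalWindowDoorLrcModEntireRidgeWiring
open Summit.NavierStokesRegularity.NavierStokesRegularity.Theorems.PoloidalWindowDoorLrcModEntireQuarticMax
open Summit.NavierStokesRegularity.NavierStokesRegularity.Theorems.PoloidalWindowDoorLrcModEntireTwistingTHFlatRidgeJet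
open Summit.NavierStokesRegularity.NavierStokesRegularity.Theorems.PoloidalWindowDoorLrcModEntireTwistingTHFlatRidgeThirdJet
open Summit.NavierStokesRegularity.NavierStokesRegularity.Theorems.PoloidalWindowDoorLrcModEntireTwistingTHFlatRidgeMixedPin
open Summit.NavierStokesRegularity.NavierStokesRegularity.Theorems.PoloidalWindowDoorLrcModEntireTwistingTHFlatRidgeQuarticLawTools
open Summit.NavierStokesRegularity.NavierStokesRegularity.Theorems.PoloidalWindowDoorLrcModEntireTwistingTHFlatRidgeQuarticPin
open Summit.NavierStokesRegularity.NavierStokesRegularity.Theorems.PoloidalWindowDoorLrcModEntireTwistingTHFlatRidgeQuarticLaw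

/-! ### Class-free: Schwarz symmetries of the fourth derivative in the currency `D²(x ↦ D²f(x)[a][b])(y)[c][d]` -/

section ClassFree

variable {E : Type*} [NormedAddCommGroup E] [NormedSpace ℝ E] {f : E → ℝ} {y : E}

/-- The Hessian entry `x ↦ D²f(x)[a][b]` of a `C⁴` function is `C²`. [folklore] -/
theorem contDiff_hessianEntry (hf : ContDiff ℝ 4 f) (a b : E) : ContDiff ℝ 2 (fun x => fderiv ℝ (fderiv ℝ f) x a b) :=
  (((hf.fderiv_right (m := 3) (by norm_num)).fderiv_right (m := 2) (by norm_num)).clm_apply contDiff_const).clm_apply contDiff_const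

/-- Outer Schwarz: `D²(x ↦ D²f(x)[a][b])(y)[c][d]` is symmetric in `(c,d)`. [folklore] -/
theorem fourthDeriv_symm_outer (hf : ContDiff ℝ 4 f) (a b c d : E) :
    fderiv ℝ (fderiv ℝ (fun x => fderiv ℝ (fderiv ℝ f) x a b)) y c d = fderiv ℝ (fderiv ℝ (fun x => fderiv ℝ (fderiv ℝ f) x a b)) y d c :=
  ((contDiff_hessianEntry hf a b).contDiffAt (x := y)).isSymmSndFDerivAt (by simp) c d

/-- Inner Schwarz: `D²(x ↦ D²f(x)[a][b])(y) = D²(x ↦ D²f(x)[b][a])(y)`. [folklore] -/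
theorem fourthDeriv_symm_inner (hf : ContDiff ℝ 4 f) (a b : E) :
    fderiv ℝ (fderiv ℝ (fun x => fderiv ℝ (fderiv ℝ f) x a b)) y = fderiv ℝ (fderiv ℝ (fun x => fderiv ℝ (fderiv ℝ f) x b a)) y := by
  have hf2 : ContDiff ℝ 2 f := hf.of_le (by norm_num)
  have e : (fun x => fderiv ℝ (fderiv ℝ f) x a b) = fun x => fderiv ℝ (fderiv ℝ f) x b a :=
    funext fun x => (hf2.contDiffAt (x := x)).isSymmSndFDerivAt (by simp) a b
  rw [e]

/-- Middle Schwarz: `D²(x ↦ D²f(x)[a][b])(y)[c][d] = D²(x ↦ D²f(x)[d][b])(y)[c][a]` (the pointwise symmetry of `D³f` in its first two slots, differentiated once more). [folklore] -/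
theorem fourthDeriv_symm_middle (hf : ContDiff ℝ 4 f) (a b c d : E) :
    fderiv ℝ (fderiv ℝ (fun x => fderiv ℝ (fderiv ℝ f) x a b)) y c d = fderiv ℝ (fderiv ℝ (fun x => fderiv ℝ (fderiv ℝ f) x d b)) y c a := by
  have hf3 : ContDiff ℝ 3 f := hf.of_le (by norm_num)
  have hab := contDiff_hessianEntry hf a b
  have hdb := contDiff_hessianEntry hf d b
  rw [fderiv_fderiv_eq_coord hab y c d, fderiv_fderiv_eq_coord hdb y c a]
  -- the two inner functions coincide: `x ↦ ∂_d (D²f(·)[a][b])(x) = D³f(x)[d][a][b] = D³f(x)[a][d][b] = ∂_a (D²f(·)[d][b])(x)`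
  have hD2d : ∀ x, DifferentiableAt ℝ (fderiv ℝ (fderiv ℝ f)) x := fun x =>
    (((hf.fderiv_right (m := 3) (by norm_num)).fderiv_right (m := 2) (by norm_num)).differentiable (by norm_num)) x
  have key : (fun x => fderiv ℝ (fun x' => fderiv ℝ (fderiv ℝ f) x' a b) x d) = fun x => fderiv ℝ (fun x' => fderiv ℝ (fderiv ℝ f) x' d b) x a := by
    funext x
    have e1 : fderiv ℝ (fun x' => fderiv ℝ (fderiv ℝ f) x' a b) x d = fderiv ℝ (fderiv ℝ (fderiv ℝ f)) x d a b := by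
      rw [show (fun x' => fderiv ℝ (fderiv ℝ f) x' a b) = fun x' => (fun x'' => fderiv ℝ (fderiv ℝ f) x'' a) x' b from rfl,
        fderiv_clm_apply ((hD2d x).clm_apply (differentiableAt_const _)) (differentiableAt_const _)]
      simp [fderiv_apply_const_apply_eq_fderiv_fderiv (hD2d x)]
    have e2 : fderiv ℝ (fun x' => fderiv ℝ (fderiv ℝ f) x' d b) x a = fderiv ℝ (fderiv ℝ (fderiv ℝ f)) x a d b := by
      rw [show (fun x' => fderiv ℝ (fderiv ℝ f) x' d b) = fun x' => (fun x'' => fderiv ℝ (fderiv ℝ f) x'' d) x' b from rfl,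
        fderiv_clm_apply ((hD2d x).clm_apply (differentiableAt_const _)) (differentiableAt_const _)]
      simp [fderiv_apply_const_apply_eq_fderiv_fderiv (hD2d x)]
    rw [e1, e2]
    exact thirdDeriv_symm₁₂ hf3.contDiffAt d a b
  rw [key]

/-- **A horizontal trace identity:** for a bilinear form `B` on `ℝ³` and a unit horizontal `T`, with `ν := (−T₁, T₀, 0)`:
`B(e₀,e₀) + B(e₁,e₁) = B(ν,ν) + B(T,T)` (the cross terms cancel; no symmetry needed). -/
theorem horizTrace_eq (B : EuclideanSpace ℝ (Fin 3) →L[ℝ] EuclideanSpace ℝ (Fin 3) →L[ℝ] ℝ)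
    {T : EuclideanSpace ℝ (Fin 3)} (hT2 : T 2 = 0) (hT1 : ‖T‖ = 1) :
    B (EuclideanSpace.single 0 1) (EuclideanSpace.single 0 1) + B (EuclideanSpace.single 1 1) (EuclideanSpace.single 1 1) =
      B ((-T 1) • EuclideanSpace.single 0 (1 : ℝ) + T 0 • EuclideanSpace.single 1 (1 : ℝ))
          ((-T 1) • EuclideanSpace.single 0 (1 : ℝ) + T 0 • EuclideanSpace.single 1 (1 : ℝ)) + B T T := by
  have hnorm : T 0 ^ 2 + T 1 ^ 2 = 1 := by
    have h := EuclideanSpace.norm_eq T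
    rw [hT1] at h
    have h2 : ∑ i : Fin 3, ‖T i‖ ^ 2 = 1 := by
      have := congrArg (fun r : ℝ => r ^ 2) h
      simp only [one_pow] at this
      rw [Real.sq_sqrt (Finset.sum_nonneg fun i _ => by positivity)] at this
      exact this.symm
    simp only [Fin.sum_univ_three, Real.norm_eq_abs, sq_abs, hT2] at h2
    linarith
  have hT : T = T 0 • EuclideanSpace.single 0 (1 : ℝ) + T 1 • EuclideanSpace.single 1 (1 : ℝ) := by
    ext i; fin_cases i <;> simp [hT2]
  have hBTT : B T T = B (T 0 • EuclideanSpace.single 0 (1 : ℝ) + T 1 • EuclideanSpace.single 1 (1 : ℝ))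
      (T 0 • EuclideanSpace.single 0 (1 : ℝ) + T 1 • EuclideanSpace.single 1 (1 : ℝ)) := by rw [← hT]
  rw [hBTT]
  simp only [map_add, map_smul, add_apply, smul_apply, smul_eq_mul]
  linear_combination (-(B (EuclideanSpace.single 0 1) (EuclideanSpace.single 0 1) + B (EuclideanSpace.single 1 1) (EuclideanSpace.single 1 1))) * hnorm

end ClassFree

/-! ### Assembly of `…QuarticPin` and `…QuarticLaw` -/

variable {C : ℝ} {v : ℝ → EuclideanSpace ℝ (Fin 3) → EuclideanSpace ℝ (Fin 3)}

/-- ★ **THE FLAT SUB-CELL AT FOURTH ORDER, assembled.**  At a flat hot point `y ∈ P₀` of a `stub_T2bFlat` profile and for every horizontal direction `ν`: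
`∃ ρ₀ ≥ 1, 3ρ₀²·(D²(Δₕv₂(−1,·))(y)[ν,ν])² ≤ (σ∂ₜ²v₂(−1,y) − 3|N|/4)·(σ·(d⁴/dn⁴)|₀ v₂(−1, y + nν))` (`Δₕθ := ∂₀∂₀θ + ∂₁∂₁θ`). -/
theorem quarticSliceTimePin_of_flatHotPoint (hdec : HasTypeITimeDecay C v) (hcont : ContinuousOn (uncurry v) (Iio (0 : ℝ) ×ˢ univ))
    (hmild : ∀ s t : ℝ, s < t → t < 0 → ∀ x, v t x = heatExtension (v s) (t - s) x - oseenDuhamel 1 s v v t x)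
    (hdiv : ∀ t < 0, VectorCalculus.IsDivFree (v t))
    (hpol : ∀ s < 0, ∀ y, ⟪curl (v s) y, EuclideanSpace.single 2 1⟫_ℝ = 0)
    (hTH : ∀ t < 0, ∀ x x' : EuclideanSpace ℝ (Fin 3), x 2 = x' 2 → ∀ b c : Fin 3, b ≠ 2 → c ≠ 2 →
      fderiv ℝ (v t) x (EuclideanSpace.single 2 1) b * fderiv ℝ (v t) x' (EuclideanSpace.single c 1) 2 =
        fderiv ℝ (v t) x' (EuclideanSpace.single 2 1) c * fderiv ℝ (v t) x (EuclideanSpace.single b 1) 2)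
    (hne : v (-1) 0 2 ≠ 0) (hhot : ∀ t < 0, ∀ x, Real.sqrt (-t) * |v t x 2| ≤ |v (-1) 0 2|)
    (hproper : ∀ y ∈ {y : EuclideanSpace ℝ (Fin 3) | y 2 = 0 ∧ v (-1) y 2 = v (-1) 0 2}, ∀ r : ℝ, 0 < r →
      ∃ y' : EuclideanSpace ℝ (Fin 3), y' 2 = 0 ∧ dist y' y < r ∧ v (-1) y' 2 ≠ v (-1) 0 2)
    {σ : ℝ} (hσN : σ * v (-1) 0 2 = |v (-1) 0 2|)
    {y : EuclideanSpace ℝ (Fin 3)} (hy0 : y 2 = 0) (hy : v (-1) y 2 = v (-1) 0 2)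
    (hflat : fderiv ℝ (fderiv ℝ (fun x => σ * v (-1) x 2)) y (EuclideanSpace.single 0 1) (EuclideanSpace.single 0 1) +
      fderiv ℝ (fderiv ℝ (fun x => σ * v (-1) x 2)) y (EuclideanSpace.single 1 1) (EuclideanSpace.single 1 1) = 0)
    {ν : EuclideanSpace ℝ (Fin 3)} (hν : ν 2 = 0) :
    ∃ ρ₀ : ℝ, 1 ≤ ρ₀ ∧
      3 * (ρ₀ * fderiv ℝ (fderiv ℝ (fun x => fderiv ℝ (fun x' => fderiv ℝ (fun y' => (v (-1) y' 2 : ℝ)) x' (EuclideanSpace.single 0 1)) x (EuclideanSpace.single 0 1) +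
          fderiv ℝ (fun x' => fderiv ℝ (fun y' => (v (-1) y' 2 : ℝ)) x' (EuclideanSpace.single 1 1)) x (EuclideanSpace.single 1 1))) y ν ν) ^ 2 ≤
        (σ * deriv (deriv (fun s => v s y 2)) (-1) - 3 * |v (-1) 0 2| / 4) * (σ * iteratedDeriv 4 (fun n : ℝ => v (-1) (y + n • ν) 2) 0) := by
  have h1 : (-1 : ℝ) ∈ Iio (0 : ℝ) := by norm_num
  obtain ⟨ρ₀, hρ₀, hrho⟩ := secondDeriv_laplacian_eq_rho_mul_horiz_of_flatHotPoint hdec hcont hmild hdiv hpol hTH hne hhot hproper hy0 hν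
  have hdyn := secondDeriv_timeDeriv_eq_secondDeriv_laplacian_of_flatHotPoint hdec hcont hmild hdiv hpol hTH hne hhot hproper hσN hy0 hy hflat hν
  have hpin := (spacetimeQuarticPin_of_flatHotPoint hdec hcont hmild hdiv hTH hne hhot hproper hσN hy0 hy hflat ν).2
  -- `b` as a line second derivative is the Hessian of `θ_t` on the diagonal
  have hθt2 : ContDiff ℝ 2 (fun x => deriv (fun s => v s x 2) (-1)) := by
    have h := ((isSmoothSpaceTimeOn_two hdec hcont hmild).isSmoothSpaceTimeOn_deriv isOpen_Iio).contDiff_slice h1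
    exact h.of_le (by exact WithTop.coe_le_coe.2 le_top)
  rw [iteratedDeriv_two_line_apply hθt2 y ν, hdyn, hrho, iteratedDeriv_const_mul_field] at hpin
  exact ⟨ρ₀, hρ₀, hpin⟩


/-! ### The secant kernel of `D⁴θ` at a flat hot point -/

/-- **THE SECANT KERNEL.**  At a hot point `y ∈ P₀` of a flat-cell profile (flat ridge law at EVERY hot point of `P₀`; hot points accumulate at `y`), there is a unit horizontal `T`
(a limit of unit secants to hot points) with `D²(x ↦ D²v₂(−1,x)[a][b])(y)[T][w] = 0` for all `a b w` — `D⁴θ(y)[T,·,·,·] = 0`. -/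
theorem exists_secantKernel_of_flatHotPoint (hdec : HasTypeITimeDecay C v) (hcont : ContinuousOn (uncurry v) (Iio (0 : ℝ) ×ˢ univ))
    (hmild : ∀ s t : ℝ, s < t → t < 0 → ∀ x, v t x = heatExtension (v s) (t - s) x - oseenDuhamel 1 s v v t x)
    (hdiv : ∀ t < 0, VectorCalculus.IsDivFree (v t))
    (hTH : ∀ t < 0, ∀ x x' : EuclideanSpace ℝ (Fin 3), x 2 = x' 2 → ∀ b c : Fin 3, b ≠ 2 → c ≠ 2 →
      fderiv ℝ (v t) x (EuclideanSpace.single 2 1) b * fderiv ℝ (v t) x' (EuclideanSpace.single c 1) 2 =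
        fderiv ℝ (v t) x' (EuclideanSpace.single 2 1) c * fderiv ℝ (v t) x (EuclideanSpace.single b 1) 2)
    (hne : v (-1) 0 2 ≠ 0) (hhot : ∀ t < 0, ∀ x, Real.sqrt (-t) * |v t x 2| ≤ |v (-1) 0 2|)
    (hproper : ∀ y ∈ {y : EuclideanSpace ℝ (Fin 3) | y 2 = 0 ∧ v (-1) y 2 = v (-1) 0 2}, ∀ r : ℝ, 0 < r →
      ∃ y' : EuclideanSpace ℝ (Fin 3), y' 2 = 0 ∧ dist y' y < r ∧ v (-1) y' 2 ≠ v (-1) 0 2)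
    (hni : ∀ K O : Set (EuclideanSpace ℝ (Fin 3)), IsCompact K → K.Nonempty → K ⊆ {y : EuclideanSpace ℝ (Fin 3) | y 2 = 0 ∧ v (-1) y 2 = v (-1) 0 2} →
      IsOpen O → K ⊆ O → O ∩ {y : EuclideanSpace ℝ (Fin 3) | y 2 = 0 ∧ v (-1) y 2 = v (-1) 0 2} ⊆ K → False)
    {σ : ℝ} (hσN : σ * v (-1) 0 2 = |v (-1) 0 2|)
    (hflatAll : ∀ y : EuclideanSpace ℝ (Fin 3), y 2 = 0 → v (-1) y 2 = v (-1) 0 2 →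
      fderiv ℝ (fderiv ℝ (fun x => σ * v (-1) x 2)) y (EuclideanSpace.single 0 1) (EuclideanSpace.single 0 1) +
        fderiv ℝ (fderiv ℝ (fun x => σ * v (-1) x 2)) y (EuclideanSpace.single 1 1) (EuclideanSpace.single 1 1) = 0)
    {y : EuclideanSpace ℝ (Fin 3)} (hy0 : y 2 = 0) (hy : v (-1) y 2 = v (-1) 0 2) :
    ∃ T : EuclideanSpace ℝ (Fin 3), T 2 = 0 ∧ ‖T‖ = 1 ∧
      ∀ a b w : EuclideanSpace ℝ (Fin 3), fderiv ℝ (fderiv ℝ (fun x => fderiv ℝ (fderiv ℝ (fun x' => (v (-1) x' 2 : ℝ))) x a b)) y T w = 0 := by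
  set θ : EuclideanSpace ℝ (Fin 3) → ℝ := fun x => v (-1) x 2 with hθdef
  have hθ : ContDiff ℝ 4 θ := contDiff_two_component hdec hcont hmild
  -- non-isolation of `y` in the hot set
  have hacc : ∀ r > 0, ∃ y' : EuclideanSpace ℝ (Fin 3), y' 2 = 0 ∧ v (-1) y' 2 = v (-1) 0 2 ∧ y' ≠ y ∧ dist y' y < r := by
    intro r hr
    by_contra hcon
    push Not at hcon
    have hK : ({y} : Set (EuclideanSpace ℝ (Fin 3))) ⊆ {y' : EuclideanSpace ℝ (Fin 3) | y' 2 = 0 ∧ v (-1) y' 2 = v (-1) 0 2} := by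
      intro z hz; rw [mem_singleton_iff.1 hz]; exact ⟨hy0, hy⟩
    have hO : ({y} : Set (EuclideanSpace ℝ (Fin 3))) ⊆ ball y r := by
      intro z hz; rw [mem_singleton_iff.1 hz]; exact mem_ball_self hr
    refine hni {y} (ball y r) isCompact_singleton (singleton_nonempty y) hK isOpen_ball hO ?_
    rintro y' ⟨hy'b, hy'2, hy'v⟩
    rw [mem_singleton_iff]
    by_contra hne'
    exact (not_lt.2 (hcon y' hy'2 hy'v hne')) (mem_ball.1 hy'b)
  choose z hz2 hzv hzne hzd using fun n : ℕ => hacc (1 / ((n : ℝ) + 1)) (by positivity)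
  have hzt : Tendsto z atTop (𝓝 y) := by
    rw [Metric.tendsto_atTop]
    intro ε hε
    obtain ⟨N, hN⟩ := exists_nat_one_div_lt hε
    refine ⟨N, fun n hn => (hzd n).trans (lt_of_le_of_lt ?_ hN)⟩
    gcongr
  -- unit secants and a convergent subsequence
  set u : ℕ → EuclideanSpace ℝ (Fin 3) := fun n => ‖z n - y‖⁻¹ • (z n - y) with hudef
  have hnorm : ∀ n, ‖z n - y‖ ≠ 0 := fun n => norm_ne_zero_iff.2 (sub_ne_zero.2 (hzne n))
  have husphere : ∀ n, u n ∈ sphere (0 : EuclideanSpace ℝ (Fin 3)) 1 := fun n => by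
    rw [mem_sphere_zero_iff_norm, hudef]
    simp only
    rw [norm_smul, norm_inv, norm_norm, inv_mul_cancel₀ (hnorm n)]
  obtain ⟨T, hTs, φ, hφ, hTlim⟩ := (isCompact_sphere (0 : EuclideanSpace ℝ (Fin 3)) 1).tendsto_subseq husphere
  refine ⟨T, ?_, by simpa using hTs, ?_⟩
  · have hc2 : Continuous fun x : EuclideanSpace ℝ (Fin 3) => x 2 := (EuclideanSpace.proj (2 : Fin 3)).continuous
    have hlim' : Tendsto (fun n => (u (φ n)) 2) atTop (𝓝 (T 2)) := (hc2.tendsto T).comp hTlim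
    have hzero : (fun n => (u (φ n)) 2) = fun _ => (0 : ℝ) := by
      funext n; simp [hudef, hz2, hy0]
    rw [hzero] at hlim'
    exact tendsto_nhds_unique hlim' tendsto_const_nhds
  · intro a b w
    -- the gradient `G := D(x ↦ D²θ(x)[a][b])` vanishes at every flat hot point (third jet), in particular at `z n` and at `y`
    set H : EuclideanSpace ℝ (Fin 3) → ℝ := fun x => fderiv ℝ (fderiv ℝ θ) x a b with hHdef
    have hH : ContDiff ℝ 2 H := contDiff_hessianEntry hθ a b
    have hθ3 : ContDiff ℝ 3 θ := hθ.of_le (by norm_num)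
    have hGzero : ∀ y' : EuclideanSpace ℝ (Fin 3), y' 2 = 0 → v (-1) y' 2 = v (-1) 0 2 → fderiv ℝ H y' = 0 := by
      intro y' hy'0 hy'
      have h3 := thirdDeriv_two_eq_zero_of_flatHotPoint hdec hcont hmild hdiv hTH hne hhot hproper hσN hy'0 hy' (hflatAll y' hy'0 hy')
      ext e
      have hb : fderiv ℝ H y' e = fderiv ℝ (fderiv ℝ (fderiv ℝ θ)) y' e a b := by
        have hD2d : DifferentiableAt ℝ (fderiv ℝ (fderiv ℝ θ)) y' :=
          (((hθ.fderiv_right (m := 3) (by norm_num)).fderiv_right (m := 2) (by norm_num)).differentiable (by norm_num)) y'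
        rw [hHdef, show (fun x => fderiv ℝ (fderiv ℝ θ) x a b) = fun x => (fun x' => fderiv ℝ (fderiv ℝ θ) x' a) x b from rfl,
          fderiv_clm_apply (hD2d.clm_apply (differentiableAt_const _)) (differentiableAt_const _)]
        simp [fderiv_apply_const_apply_eq_fderiv_fderiv hD2d]
      rw [hb, hθdef, h3]
      simp
    -- little-o of `DH` at `y` along the hot sequence
    have hD : HasFDerivAt (fderiv ℝ H) (fderiv ℝ (fderiv ℝ H) y) y :=
      (((hH.fderiv_right (m := 1) (by norm_num)).differentiable one_ne_zero) y).hasFDerivAt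
    have ht := (hasFDerivAt_iff_tendsto.1 hD).comp hzt
    have heq : (fun n => ‖z n - y‖⁻¹ * ‖fderiv ℝ H (z n) - fderiv ℝ H y - fderiv ℝ (fderiv ℝ H) y (z n - y)‖) =
        fun n => ‖fderiv ℝ (fderiv ℝ H) y (u n)‖ := by
      funext n
      rw [hGzero (z n) (hz2 n) (hzv n), hGzero y hy0 hy, sub_zero, zero_sub, norm_neg, hudef]
      simp only
      rw [map_smul, norm_smul, norm_inv, norm_norm]
    have ht' : Tendsto (fun n => ‖fderiv ℝ (fderiv ℝ H) y (u n)‖) atTop (𝓝 0) := by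
      have := ht; rw [Function.comp_def] at this; simpa only [heq] using this
    have hsub : Tendsto (fun n => ‖fderiv ℝ (fderiv ℝ H) y (u (φ n))‖) atTop (𝓝 0) := ht'.comp hφ.tendsto_atTop
    have hcontn : Continuous fun x => ‖fderiv ℝ (fderiv ℝ H) y x‖ := (fderiv ℝ (fderiv ℝ H) y).continuous.norm
    have hlim2 : Tendsto (fun n => ‖fderiv ℝ (fderiv ℝ H) y (u (φ n))‖) atTop (𝓝 ‖fderiv ℝ (fderiv ℝ H) y T‖) :=
      (hcontn.tendsto T).comp hTlim
    have h0 : ‖fderiv ℝ (fderiv ℝ H) y T‖ = 0 := tendsto_nhds_unique hlim2 hsub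
    have hT0 : fderiv ℝ (fderiv ℝ H) y T = 0 := norm_eq_zero.1 h0
    rw [hT0, zero_apply]

/-- ★ **THE BRANCH-FREE FOURTH-ORDER PIN OF THE FLAT CELL.**  At a hot point `y ∈ P₀` of a `stub_T2bFlat` profile (flat ridge law at every hot point of `P₀`, «no compact
isolated hot piece», poloidality, global (TH), hot-spot normalisation, `hproper`) there are a unit horizontal `ν` (the normal `JT` of a hot secant direction `T`) and `ρ₀ ≥ 1` with
**`3ρ₀²·(−σ∂_ν⁴θ(y)) ≤ 3|N|/4 − σ∂ₜ²v₂(−1,y)`**, i.e. the memo's `72ρ₀²q ≤ 3N/4 − σθ_tt` with `q := −σ∂_ν⁴θ(y)/24 ≥ 0`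
(`∂_ν⁴θ(y) := (d⁴/dn⁴)|₀ v₂(−1, y + nν)`). -/
theorem secantQuarticPin_of_flatHotPoint (hdec : HasTypeITimeDecay C v) (hcont : ContinuousOn (uncurry v) (Iio (0 : ℝ) ×ˢ univ))
    (hmild : ∀ s t : ℝ, s < t → t < 0 → ∀ x, v t x = heatExtension (v s) (t - s) x - oseenDuhamel 1 s v v t x)
    (hdiv : ∀ t < 0, VectorCalculus.IsDivFree (v t))
    (hpol : ∀ s < 0, ∀ y, ⟪curl (v s) y, EuclideanSpace.single 2 1⟫_ℝ = 0)
    (hTH : ∀ t < 0, ∀ x x' : EuclideanSpace ℝ (Fin 3), x 2 = x' 2 → ∀ b c : Fin 3, b ≠ 2 → c ≠ 2 →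
      fderiv ℝ (v t) x (EuclideanSpace.single 2 1) b * fderiv ℝ (v t) x' (EuclideanSpace.single c 1) 2 =
        fderiv ℝ (v t) x' (EuclideanSpace.single 2 1) c * fderiv ℝ (v t) x (EuclideanSpace.single b 1) 2)
    (hne : v (-1) 0 2 ≠ 0) (hhot : ∀ t < 0, ∀ x, Real.sqrt (-t) * |v t x 2| ≤ |v (-1) 0 2|)
    (hproper : ∀ y ∈ {y : EuclideanSpace ℝ (Fin 3) | y 2 = 0 ∧ v (-1) y 2 = v (-1) 0 2}, ∀ r : ℝ, 0 < r →
      ∃ y' : EuclideanSpace ℝ (Fin 3), y' 2 = 0 ∧ dist y' y < r ∧ v (-1) y' 2 ≠ v (-1) 0 2)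
    (hni : ∀ K O : Set (EuclideanSpace ℝ (Fin 3)), IsCompact K → K.Nonempty → K ⊆ {y : EuclideanSpace ℝ (Fin 3) | y 2 = 0 ∧ v (-1) y 2 = v (-1) 0 2} →
      IsOpen O → K ⊆ O → O ∩ {y : EuclideanSpace ℝ (Fin 3) | y 2 = 0 ∧ v (-1) y 2 = v (-1) 0 2} ⊆ K → False)
    {σ : ℝ} (hσN : σ * v (-1) 0 2 = |v (-1) 0 2|)
    (hflatAll : ∀ y : EuclideanSpace ℝ (Fin 3), y 2 = 0 → v (-1) y 2 = v (-1) 0 2 →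
      fderiv ℝ (fderiv ℝ (fun x => σ * v (-1) x 2)) y (EuclideanSpace.single 0 1) (EuclideanSpace.single 0 1) +
        fderiv ℝ (fderiv ℝ (fun x => σ * v (-1) x 2)) y (EuclideanSpace.single 1 1) (EuclideanSpace.single 1 1) = 0)
    {y : EuclideanSpace ℝ (Fin 3)} (hy0 : y 2 = 0) (hy : v (-1) y 2 = v (-1) 0 2) :
    ∃ ν : EuclideanSpace ℝ (Fin 3), ν 2 = 0 ∧ ‖ν‖ = 1 ∧ ∃ ρ₀ : ℝ, 1 ≤ ρ₀ ∧
      3 * ρ₀ ^ 2 * (-(σ * iteratedDeriv 4 (fun n : ℝ => v (-1) (y + n • ν) 2) 0)) ≤ 3 * |v (-1) 0 2| / 4 - σ * deriv (deriv (fun s => v s y 2)) (-1) := by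
  set θ : EuclideanSpace ℝ (Fin 3) → ℝ := fun x => v (-1) x 2 with hθdef
  have hθ : ContDiff ℝ 4 θ := contDiff_two_component hdec hcont hmild
  have hflat := hflatAll y hy0 hy
  obtain ⟨T, hT2, hT1, hker⟩ := exists_secantKernel_of_flatHotPoint hdec hcont hmild hdiv hTH hne hhot hproper hni hσN hflatAll hy0 hy
  set ν : EuclideanSpace ℝ (Fin 3) := (-T 1) • EuclideanSpace.single 0 (1 : ℝ) + T 0 • EuclideanSpace.single 1 (1 : ℝ) with hνdef
  have hν0 : ν 0 = -T 1 := by simp [hνdef]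
  have hν1' : ν 1 = T 0 := by simp [hνdef]
  have hν2 : ν 2 = 0 := by simp [hνdef]
  have hν1 : ‖ν‖ = 1 := by
    have h := EuclideanSpace.norm_eq T
    rw [EuclideanSpace.norm_eq ν, ← hT1, h]
    congr 1
    simp only [Fin.sum_univ_three, Real.norm_eq_abs, sq_abs, hν0, hν1', hν2, hT2]
    ring
  refine ⟨ν, hν2, hν1, ?_⟩
  obtain ⟨ρ₀, hρ₀, hpin⟩ := quarticSliceTimePin_of_flatHotPoint hdec hcont hmild hdiv hpol hTH hne hhot hproper hσN hy0 hy hflat hν2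
  refine ⟨ρ₀, hρ₀, ?_⟩
  -- ## the horizontal trace of `D²(D²θ)(y)[ν,ν]` is the pure fourth derivative `∂_ν⁴θ(y)`
  -- the function `Δₕθ = H_{e₀e₀} + H_{e₁e₁} = H_{νν} + H_{TT}` pointwise
  have hf2 : ContDiff ℝ 2 θ := hθ.of_le (by norm_num)
  have htrace : (fun x => fderiv ℝ (fun x' => fderiv ℝ θ x' (EuclideanSpace.single 0 1)) x (EuclideanSpace.single 0 1) +
        fderiv ℝ (fun x' => fderiv ℝ θ x' (EuclideanSpace.single 1 1)) x (EuclideanSpace.single 1 1)) =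
      fun x => fderiv ℝ (fderiv ℝ θ) x ν ν + fderiv ℝ (fderiv ℝ θ) x T T := by
    funext x
    rw [← fderiv_fderiv_eq_coord hf2 x, ← fderiv_fderiv_eq_coord hf2 x]
    exact horizTrace_eq (fderiv ℝ (fderiv ℝ θ) x) hT2 hT1
  have hHνν : ContDiff ℝ 2 (fun x => fderiv ℝ (fderiv ℝ θ) x ν ν) := contDiff_hessianEntry hθ ν ν
  have hHTT : ContDiff ℝ 2 (fun x => fderiv ℝ (fderiv ℝ θ) x T T) := contDiff_hessianEntry hθ T T
  have hsplit : fderiv ℝ (fderiv ℝ (fun x => fderiv ℝ (fun x' => fderiv ℝ θ x' (EuclideanSpace.single 0 1)) x (EuclideanSpace.single 0 1) +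
        fderiv ℝ (fun x' => fderiv ℝ θ x' (EuclideanSpace.single 1 1)) x (EuclideanSpace.single 1 1))) y ν ν =
      fderiv ℝ (fderiv ℝ (fun x => fderiv ℝ (fderiv ℝ θ) x ν ν)) y ν ν := by
    rw [htrace]
    have hd1 : ∀ x, DifferentiableAt ℝ (fun x => fderiv ℝ (fderiv ℝ θ) x ν ν) x := fun x => (hHνν.differentiable (by norm_num)) x
    have hd2 : ∀ x, DifferentiableAt ℝ (fun x => fderiv ℝ (fderiv ℝ θ) x T T) x := fun x => (hHTT.differentiable (by norm_num)) x
    have e1 : fderiv ℝ (fun x => fderiv ℝ (fderiv ℝ θ) x ν ν + fderiv ℝ (fderiv ℝ θ) x T T) =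
        fderiv ℝ (fun x => fderiv ℝ (fderiv ℝ θ) x ν ν) + fderiv ℝ (fun x => fderiv ℝ (fderiv ℝ θ) x T T) := by
      funext x; exact fderiv_fun_add (hd1 x) (hd2 x)
    have hD1 : DifferentiableAt ℝ (fderiv ℝ (fun x => fderiv ℝ (fderiv ℝ θ) x ν ν)) y :=
      ((hHνν.fderiv_right (m := 1) (by norm_num)).differentiable one_ne_zero) y
    have hD2 : DifferentiableAt ℝ (fderiv ℝ (fun x => fderiv ℝ (fderiv ℝ θ) x T T)) y :=
      ((hHTT.fderiv_right (m := 1) (by norm_num)).differentiable one_ne_zero) y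
    rw [e1, fderiv_add hD1 hD2]
    simp only [add_apply]
    -- the `T`-term vanishes: `D⁴θ(y)[ν,ν,T,T] = D⁴θ(y)[T,ν,ν,T] = 0`
    have hTT : fderiv ℝ (fderiv ℝ (fun x => fderiv ℝ (fderiv ℝ θ) x T T)) y ν ν = 0 := by
      rw [fourthDeriv_symm_middle hθ T T ν ν, fourthDeriv_symm_outer hθ ν T ν T]
      exact hker ν T ν
    rw [hTT, add_zero]
  -- ## `∂_ν⁴θ(y)` as an iterated line derivative
  have hline4 : iteratedDeriv 4 (fun n : ℝ => v (-1) (y + n • ν) 2) 0 = fderiv ℝ (fderiv ℝ (fun x => fderiv ℝ (fderiv ℝ θ) x ν ν)) y ν ν := by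
    -- second line derivative as a function of the base point: `d²/dn² θ(y + nν)|ₛ = D²θ(y + sν)[ν,ν]`
    have hℓ2 : iteratedDeriv 2 (fun n : ℝ => v (-1) (y + n • ν) 2) = fun s => fderiv ℝ (fderiv ℝ θ) (y + s • ν) ν ν := by
      funext s
      have hshift := congrFun (iteratedDeriv_comp_const_add 2 (fun n : ℝ => v (-1) (y + n • ν) 2) s) 0
      rw [add_zero] at hshift
      rw [← hshift]
      have e : (fun z : ℝ => (fun n : ℝ => v (-1) (y + n • ν) 2) (s + z)) = fun z : ℝ => θ ((y + s • ν) + z • ν) := by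
        funext z
        show v (-1) (y + (s + z) • ν) 2 = v (-1) (y + s • ν + z • ν) 2
        rw [add_smul, add_assoc]
      rw [e, iteratedDeriv_two_line_apply hf2 (y + s • ν) ν]
    have e4 : iteratedDeriv 4 (fun n : ℝ => v (-1) (y + n • ν) 2) 0 = iteratedDeriv 2 (iteratedDeriv 2 (fun n : ℝ => v (-1) (y + n • ν) 2)) 0 := by
      simp only [iteratedDeriv_eq_iterate]
      rw [show (4 : ℕ) = 2 + 2 from rfl, Function.iterate_add_apply]
    rw [e4, hℓ2, iteratedDeriv_two_line_apply hHνν y ν]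
  -- ## conclude
  rw [hsplit, ← hline4] at hpin
  have hQ := quarticSign_of_flatHotPoint hdec hcont hmild hdiv hTH hne hhot hproper hσN hy0 hy hflat ν
  have hA : σ * deriv (deriv (fun s => v s y 2)) (-1) ≤ 3 * |v (-1) 0 2| / 4 := timeTimePin_of_hotPoint hdec hcont hmild hne hhot hσN hy
  have hσ2 : σ ^ 2 = 1 := by
    have h := abs_sigma_eq_one hne hσN
    have := sq_abs σ; rw [h] at this; linarith
  obtain ⟨Q, hQdef⟩ : ∃ Q : ℝ, Q = iteratedDeriv 4 (fun n : ℝ => v (-1) (y + n • ν) 2) 0 := ⟨_, rfl⟩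
  obtain ⟨M, hMdef⟩ : ∃ M : ℝ, M = 3 * |v (-1) 0 2| / 4 - σ * deriv (deriv (fun s => v s y 2)) (-1) := ⟨_, rfl⟩
  rw [← hQdef] at hpin hQ ⊢
  rw [← hMdef]
  have hM : 0 ≤ M := by rw [hMdef]; linarith only [hA]
  have hP : 0 ≤ -(σ * Q) := by linarith only [hQ]
  have key : 3 * ρ₀ ^ 2 * (-(σ * Q)) * (-(σ * Q)) ≤ M * (-(σ * Q)) := by
    have e1 : 3 * ρ₀ ^ 2 * (-(σ * Q)) * (-(σ * Q)) = 3 * (ρ₀ * Q) ^ 2 := by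
      have : σ ^ 2 * Q ^ 2 = Q ^ 2 := by rw [hσ2, one_mul]
      nlinarith only [this]
    have e2 : M * (-(σ * Q)) = (σ * deriv (deriv (fun s => v s y 2)) (-1) - 3 * |v (-1) 0 2| / 4) * (σ * Q) := by rw [hMdef]; ring
    rw [e1, e2]
    exact hpin
  rcases hP.eq_or_lt with hP0 | hPpos
  · rw [← hP0, mul_zero]; exact hM
  · exact le_of_mul_le_mul_right key hPpos

end Summit.NavierStokesRegularity.NavierStokesRegularity.Theorems.PoloidalWindowDoorLrcModEntireTwistingTHFlatRidgeSecantPin
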